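import Mathlib
import Summits.ValiantsHypothesis.ValiantsHypothesis.Theses.BarrierLever
import Summits.ValiantsHypothesis.ValiantsHypothesis.Theorems.BarrierLeverTransversalSufficesForPrincipalDictionary

/-!
# TT ⇒ TNS: transversal-minor layouts control principal-minor layouts (the item)

Item `stmt-ValiantsHypothesis-19153` (`BarrierLever.TransversalSufficesForPrincipal`, route
`route-ValiantsHypothesis-BarrierLever`, cell valiant-natproofs, rung V4, 𝒟-side of door (c)),
part 2 of 2; part 1 (`…TransversalSufficesForPrincipalDictionary`) proves the dictionary
`det B · det K[u ⊔ w] = ± Θ_H[u,w]` for `K = X⁻¹ Y` on the index type `α ⊕ α`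
(`exists_principal_layout_det_ne_zero`).

Here: (1) **genericity** — if some complex matrix makes the transversal layout determinant
nonzero then some matrix makes it nonzero together with `det B ≠ 0` (`B` = lower-left block):
both are evaluations of fixed polynomials in the generic matrix `(X_{pq})`
(`Matrix.mvPolynomialX`), a product of two nonzero polynomials over the domain `ℂ[X]` is nonzero,
and a nonzero polynomial over the infinite field `ℂ` has a non-root (`MvPolynomial.funext`);
(2) **transport** along `finSumFinEquiv : Fin h ⊕ Fin h ≃ Fin (h + h)` (`inl a ↦ castAdd a`,
`inr c ↦ natAdd c`) between the item's index sets `u.map castAddEmb ∪ w.map natAddEmb` and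
`u.disjSum w`, and between the item's row/column selectors and `ρ_u` / `σ_w`;
(3) the item **`transversalSufficesForPrincipal`**, closing type = the route decl
`Summit.ValiantsHypothesis.ValiantsHypothesis.Theses.BarrierLever.TransversalSufficesForPrincipal`.

## What this is NOT

Not a proof of TT (item 19152) or TNS (item 19126), which stay open conjectures with census
evidence through `h = 8` (kit j246911, j247658); nothing about `PartitionMinorsHitByVP`
(stmt-19717) beyond the arrow, nor about crux `SuccinctHittingSetsForVP` (stmt-14610). [folklore]
-/

-- layout Summits/ValiantsHypothesis/ValiantsHypothesis forces the duplicated namespace component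
set_option linter.dupNamespace false

namespace Summit.ValiantsHypothesis.ValiantsHypothesis.Theorems.BarrierLever.TransversalDictionary

open Matrix

/-! ## Genericity over `ℂ`: the open condition `det B ≠ 0` comes for free -/

section generic

/-- evaluating the generic matrix `(X_{pq})` at the entries of `A` commutes with taking the
determinant of any submatrix pattern. -/
theorem eval_det_submatrix_mvPolynomialX {m k : Type*} [Fintype m] [DecidableEq m] [Fintype k]
    [DecidableEq k] (A : Matrix m m ℂ) (ρ τ : k → m) :
    MvPolynomial.eval (fun pq : m × m => A pq.1 pq.2)
        ((Matrix.mvPolynomialX m m ℂ).submatrix ρ τ).det = (A.submatrix ρ τ).det := by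
  rw [RingHom.map_det, RingHom.mapMatrix_apply, ← Matrix.submatrix_map,
    ← RingHom.mapMatrix_apply, Matrix.mvPolynomialX_mapMatrix_eval]

/-- two nonzero polynomials over `ℂ` are simultaneously nonzero at some point. -/
theorem exists_eval_ne_zero_and {σ : Type*} {P Q : MvPolynomial σ ℂ} (hP : P ≠ 0)
    (hQ : Q ≠ 0) :
    ∃ x : σ → ℂ, MvPolynomial.eval x P ≠ 0 ∧ MvPolynomial.eval x Q ≠ 0 := by
  by_contra hcon
  push Not at hcon
  refine mul_ne_zero hP hQ (MvPolynomial.funext fun x => ?_)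
  rw [map_mul, map_zero]
  by_cases hx : MvPolynomial.eval x P = 0
  · rw [hx, zero_mul]
  · rw [hcon x hx, mul_zero]

/-- the item's transversal layout determinant `det (det A[ρ(u_i), τ(w_j)])_{i,j}` (rows `a` if
`a ∈ u_i` else `h + a`; columns `h + c` if `c ∈ w_j` else `c`) is a polynomial function of the
matrix entries: evaluating it on the generic matrix and then at `A` gives its value at `A`. -/
theorem eval_det_transversalLayout {h r : ℕ} (u w : Fin r → Finset (Fin h))
    (A : Matrix (Fin (h + h)) (Fin (h + h)) ℂ) :
    MvPolynomial.eval (fun pq : Fin (h + h) × Fin (h + h) => A pq.1 pq.2)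
        (Matrix.of fun i j : Fin r => ((Matrix.mvPolynomialX (Fin (h + h)) (Fin (h + h)) ℂ).submatrix
          (fun a : Fin h => if a ∈ u i then Fin.castAdd h a else Fin.natAdd h a)
          (fun c : Fin h => if c ∈ w j then Fin.natAdd h c else Fin.castAdd h c)).det).det =
      (Matrix.of fun i j : Fin r => (A.submatrix
          (fun a : Fin h => if a ∈ u i then Fin.castAdd h a else Fin.natAdd h a)
          (fun c : Fin h => if c ∈ w j then Fin.natAdd h c else Fin.castAdd h c)).det).det := by
  rw [RingHom.map_det, RingHom.mapMatrix_apply]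
  congr 1
  ext i j
  simp only [Matrix.map_apply, Matrix.of_apply]
  exact eval_det_submatrix_mvPolynomialX A _ _

/-- the `0/1` matrix with `1` exactly at the positions `(q + h, q)`: its lower-left block is `1`. -/
theorem lowerLeft_witness (h : ℕ) :
    ((Matrix.of fun p q : Fin (h + h) => if (p : ℕ) = q + h then (1 : ℂ) else 0).submatrix
        (Fin.natAdd h) (Fin.castAdd h)) = 1 := by
  ext a c
  simp only [Matrix.submatrix_apply, Matrix.of_apply, Fin.val_natAdd, Fin.val_castAdd,
    Matrix.one_apply, Fin.ext_iff]
  by_cases hac : (a : ℕ) = c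
  · rw [if_pos (by omega), if_pos hac]
  · rw [if_neg (by omega), if_neg hac]

/-- **Genericity.** If some `H` makes the transversal layout determinant nonzero, then some `H`
makes it nonzero together with `det B ≠ 0` (`B` = the lower-left `h × h` block). -/
theorem exists_transversalLayout_ne_zero_and_lowerLeft {h r : ℕ} (u w : Fin r → Finset (Fin h))
    (hex : ∃ H : Matrix (Fin (h + h)) (Fin (h + h)) ℂ, (Matrix.of fun i j : Fin r => (H.submatrix
      (fun a : Fin h => if a ∈ u i then Fin.castAdd h a else Fin.natAdd h a)
      (fun c : Fin h => if c ∈ w j then Fin.natAdd h c else Fin.castAdd h c)).det).det ≠ 0) :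
    ∃ H : Matrix (Fin (h + h)) (Fin (h + h)) ℂ, (Matrix.of fun i j : Fin r => (H.submatrix
        (fun a : Fin h => if a ∈ u i then Fin.castAdd h a else Fin.natAdd h a)
        (fun c : Fin h => if c ∈ w j then Fin.natAdd h c else Fin.castAdd h c)).det).det ≠ 0 ∧
      (H.submatrix (Fin.natAdd h) (Fin.castAdd h)).det ≠ 0 := by
  obtain ⟨H₀, hH₀⟩ := hex
  set G := Matrix.mvPolynomialX (Fin (h + h)) (Fin (h + h)) ℂ with hG
  -- `P` = the layout determinant of the generic matrix, `Q` = det of its lower-left block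
  have hP : (Matrix.of fun i j : Fin r => (G.submatrix
      (fun a : Fin h => if a ∈ u i then Fin.castAdd h a else Fin.natAdd h a)
      (fun c : Fin h => if c ∈ w j then Fin.natAdd h c else Fin.castAdd h c)).det).det ≠ 0 := by
    intro hzero
    apply hH₀
    rw [← eval_det_transversalLayout u w H₀, ← hG, hzero, map_zero]
  have hQ : (G.submatrix (Fin.natAdd h) (Fin.castAdd h)).det ≠ 0 := by
    intro hzero
    have h1 := eval_det_submatrix_mvPolynomialX
      (Matrix.of fun p q : Fin (h + h) => if (p : ℕ) = q + h then (1 : ℂ) else 0)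
      (Fin.natAdd h) (Fin.castAdd h)
    rw [← hG, hzero, map_zero, lowerLeft_witness, Matrix.det_one] at h1
    exact zero_ne_one h1
  obtain ⟨x, hx1, hx2⟩ := exists_eval_ne_zero_and hP hQ
  refine ⟨Matrix.of fun p q => x (p, q), ?_, ?_⟩
  · rwa [← eval_det_transversalLayout u w, ← hG]
  · have h2 := eval_det_submatrix_mvPolynomialX (Matrix.of fun p q : Fin (h + h) => x (p, q))
      (Fin.natAdd h) (Fin.castAdd h)
    rw [← hG] at h2
    rw [← h2]
    exact hx2

end generic

/-! ## Transport `Fin h ⊕ Fin h ≃ Fin (h + h)` and the item -/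

section transport

/-- membership in the item's index set `u.map castAdd ∪ w.map natAdd` is membership in
`u ⊕ w` after `finSumFinEquiv`. -/
theorem mem_layoutSet_iff {h : ℕ} (u w : Finset (Fin h)) (x : Fin (h + h)) :
    x ∈ u.map (Fin.castAddEmb h) ∪ w.map (Fin.natAddEmb h) ↔
      finSumFinEquiv.symm x ∈ u.disjSum w := by
  obtain ⟨y, rfl⟩ := finSumFinEquiv.surjective x
  rw [Equiv.symm_apply_apply, Finset.mem_union, Finset.mem_map, Finset.mem_map]
  rcases y with a | c
  · rw [finSumFinEquiv_apply_left, Finset.inl_mem_disjSum]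
    constructor
    · rintro (⟨b, hb, hba⟩ | ⟨b, -, hba⟩)
      · rw [Fin.castAddEmb_apply] at hba
        rwa [← Fin.castAdd_injective _ _ hba]
      · exfalso
        rw [Fin.natAddEmb_apply, Fin.ext_iff, Fin.val_natAdd, Fin.val_castAdd] at hba
        have := a.2
        omega
    · intro ha
      exact Or.inl ⟨a, ha, rfl⟩
  · rw [finSumFinEquiv_apply_right, Finset.inr_mem_disjSum]
    constructor
    · rintro (⟨b, -, hbc⟩ | ⟨b, hb, hbc⟩)
      · exfalso
        rw [Fin.castAddEmb_apply, Fin.ext_iff, Fin.val_natAdd, Fin.val_castAdd] at hbc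
        have := b.2
        omega
      · rw [Fin.natAddEmb_apply] at hbc
        rwa [← Fin.natAdd_injective _ _ hbc]
    · intro hc
      exact Or.inr ⟨c, hc, rfl⟩

/-- transporting a principal minor along `finSumFinEquiv`: the principal minor of
`K'.submatrix e.symm e.symm` on `u.map castAdd ∪ w.map natAdd` is the principal minor of `K'` on
`u ⊕ w`. -/
theorem det_principal_transport {h : ℕ} (K' : Matrix (Fin h ⊕ Fin h) (Fin h ⊕ Fin h) ℂ)
    (u w : Finset (Fin h)) :
    ((K'.submatrix finSumFinEquiv.symm finSumFinEquiv.symm).submatrix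
        (Subtype.val : ↥(u.map (Fin.castAddEmb h) ∪ w.map (Fin.natAddEmb h)) → Fin (h + h))
        (Subtype.val :
          ↥(u.map (Fin.castAddEmb h) ∪ w.map (Fin.natAddEmb h)) → Fin (h + h))).det =
      (K'.submatrix (Subtype.val : ↥(u.disjSum w) → Fin h ⊕ Fin h)
        (Subtype.val : ↥(u.disjSum w) → Fin h ⊕ Fin h)).det := by
  let eS : ↥(u.map (Fin.castAddEmb h) ∪ w.map (Fin.natAddEmb h)) ≃ ↥(u.disjSum w) :=
    (finSumFinEquiv (m := h) (n := h)).symm.subtypeEquiv fun x => mem_layoutSet_iff u w x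
  rw [← Matrix.det_submatrix_equiv_self eS
    (K'.submatrix (Subtype.val : ↥(u.disjSum w) → Fin h ⊕ Fin h)
      (Subtype.val : ↥(u.disjSum w) → Fin h ⊕ Fin h))]
  rfl

/-- the item's transversal submatrices, read on `Fin h ⊕ Fin h`. -/
theorem transversal_submatrix_eq {h : ℕ} (u w : Finset (Fin h))
    (H : Matrix (Fin (h + h)) (Fin (h + h)) ℂ) :
    H.submatrix (fun a : Fin h => if a ∈ u then Fin.castAdd h a else Fin.natAdd h a)
        (fun c : Fin h => if c ∈ w then Fin.natAdd h c else Fin.castAdd h c) =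
      (H.submatrix finSumFinEquiv finSumFinEquiv).submatrix
        (fun a : Fin h => if a ∈ u then (Sum.inl a : Fin h ⊕ Fin h) else Sum.inr a)
        (fun c : Fin h => if c ∈ w then (Sum.inr c : Fin h ⊕ Fin h) else Sum.inl c) := by
  rw [Matrix.submatrix_submatrix]
  ext a c
  simp only [Matrix.submatrix_apply, Function.comp_apply]
  congr 1
  · split_ifs <;> simp
  · split_ifs <;> simp

/-- **TT ⇒ TNS for one layout**: from a matrix `H` whose transversal layout matrix is
nonsingular we get a matrix `K` whose principal-minor layout matrix is nonsingular. -/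
theorem exists_principal_layout_ne_zero {h r : ℕ} (u w : Fin r → Finset (Fin h))
    (hex : ∃ H : Matrix (Fin (h + h)) (Fin (h + h)) ℂ, (Matrix.of fun i j : Fin r => (H.submatrix
      (fun a : Fin h => if a ∈ u i then Fin.castAdd h a else Fin.natAdd h a)
      (fun c : Fin h => if c ∈ w j then Fin.natAdd h c else Fin.castAdd h c)).det).det ≠ 0) :
    ∃ K : Matrix (Fin (h + h)) (Fin (h + h)) ℂ, (Matrix.of fun i j : Fin r => (K.submatrix
      (Subtype.val :
        ↥((u i).map (Fin.castAddEmb h) ∪ (w j).map (Fin.natAddEmb h)) → Fin (h + h))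
      (Subtype.val : ↥((u i).map (Fin.castAddEmb h) ∪ (w j).map (Fin.natAddEmb h)) →
        Fin (h + h))).det).det ≠ 0 := by
  obtain ⟨H, hΘ, hB⟩ := exists_transversalLayout_ne_zero_and_lowerLeft u w hex
  set H' : Matrix (Fin h ⊕ Fin h) (Fin h ⊕ Fin h) ℂ :=
    H.submatrix finSumFinEquiv finSumFinEquiv with hH'
  have hB' : (H'.submatrix Sum.inr Sum.inl).det ≠ 0 := by
    rw [hH', Matrix.submatrix_submatrix]
    have e1 : (⇑(finSumFinEquiv (m := h) (n := h)) ∘ Sum.inr) = Fin.natAdd h :=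
      funext fun c => finSumFinEquiv_apply_right c
    have e2 : (⇑(finSumFinEquiv (m := h) (n := h)) ∘ Sum.inl) = Fin.castAdd h :=
      funext fun a => finSumFinEquiv_apply_left a
    rw [e1, e2]
    exact hB
  have hΘ' : (Matrix.of fun i j : Fin r =>
      (H'.submatrix (fun a : Fin h => if a ∈ u i then (Sum.inl a : Fin h ⊕ Fin h) else Sum.inr a)
        (fun c : Fin h => if c ∈ w j then (Sum.inr c : Fin h ⊕ Fin h) else Sum.inl c)).det).det
          ≠ 0 := by
    have hmat : (Matrix.of fun i j : Fin r =>
        (H'.submatrix (fun a : Fin h => if a ∈ u i then (Sum.inl a : Fin h ⊕ Fin h) else Sum.inr a)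
          (fun c : Fin h => if c ∈ w j then (Sum.inr c : Fin h ⊕ Fin h) else Sum.inl c)).det) =
        Matrix.of fun i j : Fin r => (H.submatrix
          (fun a : Fin h => if a ∈ u i then Fin.castAdd h a else Fin.natAdd h a)
          (fun c : Fin h => if c ∈ w j then Fin.natAdd h c else Fin.castAdd h c)).det := by
      ext i j
      rw [Matrix.of_apply, Matrix.of_apply, transversal_submatrix_eq (u i) (w j) H]
    rw [hmat]
    exact hΘ
  obtain ⟨K', hK'⟩ := exists_principal_layout_det_ne_zero hB' u w hΘ'
  refine ⟨K'.submatrix finSumFinEquiv.symm finSumFinEquiv.symm, ?_⟩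
  have hmat : (Matrix.of fun i j : Fin r =>
      ((K'.submatrix finSumFinEquiv.symm finSumFinEquiv.symm).submatrix
        (Subtype.val :
          ↥((u i).map (Fin.castAddEmb h) ∪ (w j).map (Fin.natAddEmb h)) → Fin (h + h))
        (Subtype.val : ↥((u i).map (Fin.castAddEmb h) ∪ (w j).map (Fin.natAddEmb h)) →
          Fin (h + h))).det) =
      Matrix.of fun i j : Fin r => (K'.submatrix
        (Subtype.val : ↥((u i).disjSum (w j)) → Fin h ⊕ Fin h)
        (Subtype.val : ↥((u i).disjSum (w j)) → Fin h ⊕ Fin h)).det := by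
    ext i j
    exact det_principal_transport K' (u i) (w j)
  rw [hmat]
  exact hK'

end transport

/-- **Item `stmt-ValiantsHypothesis-19153` (`BarrierLever.TransversalSufficesForPrincipal`):
conjecture TT (every square layout matrix of transversal `h × h` minors of a `(h+h) × (h+h)`
matrix is nonsingular for some numeric matrix) implies conjecture TNS (the same for the
principal-minor layout matrices `(det K[u_i ⊔ w_j])`).  Witness: `K = X⁻¹ Y`
(`= [[-AB⁻¹, C - AB⁻¹D], [B⁻¹, B⁻¹D]]` for `H = [[A, C], [B, D]]`, with `det B ≠ 0` arranged
by genericity), whose principal-minor layout matrix is `diag(±(det B)⁻¹) · Θ_H[U,W]`. -/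
theorem transversalSufficesForPrincipal :
    Summit.ValiantsHypothesis.ValiantsHypothesis.Theses.BarrierLever.TransversalSufficesForPrincipal :=
  fun hTT h r u w hu hw => exists_principal_layout_ne_zero u w (hTT h r u w hu hw)

end Summit.ValiantsHypothesis.ValiantsHypothesis.Theorems.BarrierLever.TransversalDictionary
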